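import Summits.FinalStateConjecture.FinalStateConjecture.Theorems.SwallowTheDatumParametricKerrBurialStubBreathing
import Literature.Geometry.Lorentzian.TameFamilyOffCompact
import HarnessLib

/-!
# Route `ExactKerrEnds`, crux `TameEscapeToKerrEnds` (stmt-FinalStateConjecture-18522), line
# `matched-kerr-solution-map`: preparations for stub S3b `TameJunction`

Bookkeeping for the tame junction (`ExactKerrEndsTameEscapeToKerrEndsTameJunction.lean`), all
proved, no definitions:

* §1 `wDist_restrict_le_of_sub_eq` — the weighted `C² × C¹` distance on a collared end
  `e.restrict _` is dominated by that on `e` for data whose chart-component differences agree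
  beyond the collar (`AFEnd.wDist_restrict_eq`, locality of `iteratedFDeriv`);
* §2 the reparametrisation `(c, x) ↦ ((R⋆ + 1 + ‖c‖⁻², c₀), x)` of `ℝ¹ × X` (`radiusOf` of the
  sibling line `SwallowTheDatum.ParametricKerrBurial`, read with the coordinate `c₀` itself as the
  breathing parameter) and `contMDiff_section_of_radiusCoord` — smoothness at the junction `c = 0`
  of a family `F c = S (R⋆ + 1 + ‖c‖⁻², c₀)`, `F 0 = d`, by local exhaustion
  (`AFEnd.exists_nhds_forall_not_mem_far`), the analogue of the landed `contMDiff_family_section`;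
* §3 `smoothSectionsOn_breatheFamily_radius` — breathing a radius-indexed family `G R` agreeing
  with `d` off `e.far R` inside a ball below `R⋆` gives a two-parameter family
  `S (R, t) = breathe(σ t)^* (G R)` with jointly smooth sections on `{R⋆ < R}` (the `key` step of
  the landed `stub_breathing` of the sibling line), and the agreement lemmas feeding it; the
  registered form `breatheFamilyRadius_smoothSections`.

Christodoulou, CQG 16 (1999) A23, p. A24; Lee, *Introduction to Smooth Manifolds* (2013),
Prop. 2.25; Bartnik, CPAM 39 (1986), §1.
-/

set_option linter.dupNamespace false

noncomputable section

namespace Summit.FinalStateConjecture.FinalStateConjecture.Theorems.ExactKerrEnds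

open scoped Manifold ContDiff Topology ENNReal
open Bundle Set Filter Function Metric TopologicalSpace Literature.Geometry.Lorentzian
open Summit.FinalStateConjecture.FinalStateConjecture.Theorems.SwallowTheDatum
  (AFEnd.exists_nhds_forall_not_mem_far)
open Summit.FinalStateConjecture.FinalStateConjecture.Theorems.SwallowTheDatum.ParametricKerrBurial
  (SmoothSectionsOn AgreeAt radiusOf radiusOf_gt contDiffOn_radiusOf lt_inv_norm_sq
    exists_breathingData_le not_mem_far_of_mem_carrier)

variable {X : Type} [TopologicalSpace X] [ChartedSpace E3 X] [IsManifold (𝓡 3) ∞ X]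

/-! ## §1 The weighted distance on a collared end is dominated by that on the end -/

/-- **Collared weighted distance bounded by the end's**, for data whose chart-component
differences agree beyond the collar radius: if `hCoeff e D₁ − hCoeff e D₂ = hCoeff e D₃ − hCoeff e D₄`
and `kCoeff e D₁ − kCoeff e D₂ = kCoeff e D₃ − kCoeff e D₄` on `{R₁ < ‖y‖}`, then
`(e.restrict _).wDist D₁ D₂ ≤ e.wDist D₃ D₄` (`AFEnd.wDist_restrict_eq`: the left side is the
`iSup` over `R₁ < ‖x‖` of the same local integrands; `iteratedFDeriv` is local). [folklore] -/
theorem wDist_restrict_le_of_sub_eq (e : AFEnd X) {R₁ : ℝ} (hR₁ : e.R ≤ R₁)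
    {D₁ D₂ D₃ D₄ : InitialDataSet (𝓡 3) X}
    (hh : ∀ y : E3, R₁ < ‖y‖ →
      AFEnd.hCoeff e D₁ y - AFEnd.hCoeff e D₂ y = AFEnd.hCoeff e D₃ y - AFEnd.hCoeff e D₄ y)
    (hk : ∀ y : E3, R₁ < ‖y‖ →
      AFEnd.kCoeff e D₁ y - AFEnd.kCoeff e D₂ y = AFEnd.kCoeff e D₃ y - AFEnd.kCoeff e D₄ y) :
    (e.restrict hR₁).wDist D₁ D₂ ≤ e.wDist D₃ D₄ := by
  rw [e.wDist_restrict_eq hR₁]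
  unfold AFEnd.wDist
  refine add_le_add (iSup₂_le fun m hm ↦ iSup₂_le fun x hx ↦ ?_)
    (iSup₂_le fun m hm ↦ iSup₂_le fun x hx ↦ ?_)
  · have hev : (fun y ↦ AFEnd.hCoeff e D₁ y - AFEnd.hCoeff e D₂ y) =ᶠ[𝓝 x]
        fun y ↦ AFEnd.hCoeff e D₃ y - AFEnd.hCoeff e D₄ y := by
      filter_upwards [(isOpen_lt continuous_const continuous_norm).mem_nhds hx] with y hy
      exact hh y hy
    rw [(hev.iteratedFDeriv ℝ m).eq_of_nhds]
    exact le_iSup₂_of_le m hm <| le_iSup₂_of_le (f := fun (x : E3) (_ : e.R < ‖x‖) ↦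
      ENNReal.ofReal (‖x‖ ^ (1 + m)) *
        ‖iteratedFDeriv ℝ m (fun y ↦ AFEnd.hCoeff e D₃ y - AFEnd.hCoeff e D₄ y) x‖ₑ)
      x (lt_of_le_of_lt hR₁ hx) le_rfl
  · have hev : (fun y ↦ AFEnd.kCoeff e D₁ y - AFEnd.kCoeff e D₂ y) =ᶠ[𝓝 x]
        fun y ↦ AFEnd.kCoeff e D₃ y - AFEnd.kCoeff e D₄ y := by
      filter_upwards [(isOpen_lt continuous_const continuous_norm).mem_nhds hx] with y hy
      exact hk y hy
    rw [(hev.iteratedFDeriv ℝ m).eq_of_nhds]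
    exact le_iSup₂_of_le m hm <| le_iSup₂_of_le (f := fun (x : E3) (_ : e.R < ‖x‖) ↦
      ENNReal.ofReal (‖x‖ ^ (2 + m)) *
        ‖iteratedFDeriv ℝ m (fun y ↦ AFEnd.kCoeff e D₃ y - AFEnd.kCoeff e D₄ y) x‖ₑ)
      x (lt_of_le_of_lt hR₁ hx) le_rfl

/-! ## §2 The reparametrisation `c ↦ ((R⋆ + 1 + ‖c‖⁻², c₀), x)` and smoothness at the junction -/

omit [IsManifold (𝓡 3) ∞ X] in
/-- The parameter map `(c, x) ↦ ((R⋆ + 1 + ‖c‖⁻², c₀), x)` is smooth off `c = 0`. [folklore] -/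
theorem contMDiffOn_radiusCoordMap (Rstar : ℝ) :
    ContMDiffOn (𝓘(ℝ, EuclideanSpace ℝ (Fin 1)).prod (𝓡 3)) ((𝓘(ℝ, ℝ).prod 𝓘(ℝ, ℝ)).prod (𝓡 3)) ∞
      (fun q : EuclideanSpace ℝ (Fin 1) × X ↦ ((radiusOf Rstar q.1, q.1 0), q.2)) {q | q.1 ≠ 0} := by
  -- `c ↦ c₀` is smooth (Mathlib `contDiff_piLp_apply`; cf. `PhotonSphereChannels.contDiff_euclideanOne_apply`)
  have h0 : ContDiff ℝ ∞ (fun c : EuclideanSpace ℝ (Fin 1) ↦ c 0) :=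
    contDiff_piLp_apply (𝕜 := ℝ) (n := ∞) (p := 2) (E := fun _ : Fin 1 => ℝ) (i := 0)
  exact ((((contDiffOn_radiusOf Rstar).contMDiffOn).comp contMDiffOn_fst fun _ hq ↦ hq).prodMk
    (h0.contMDiff.comp_contMDiffOn contMDiffOn_fst)).prodMk contMDiffOn_snd

omit [IsManifold (𝓡 3) ∞ X] in
/-- The comparison parameter map `(c, x) ↦ (c₀, x)` is smooth. [folklore] -/
theorem contMDiff_coordMap :
    ContMDiff (𝓘(ℝ, EuclideanSpace ℝ (Fin 1)).prod (𝓡 3)) (𝓘(ℝ, ℝ).prod (𝓡 3)) ∞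
      (fun q : EuclideanSpace ℝ (Fin 1) × X ↦ (q.1 0, q.2)) := by
  have h0 : ContDiff ℝ ∞ (fun c : EuclideanSpace ℝ (Fin 1) ↦ c 0) :=
    contDiff_piLp_apply (𝕜 := ℝ) (n := ∞) (p := 2) (E := fun _ : Fin 1 => ℝ) (i := 0)
  exact (h0.contMDiff.comp contMDiff_fst).prodMk contMDiff_snd

/-- Radii beyond a given bound are reached by all small non-zero parameters:
`ρ₀ ≤ R⋆ + 1 + ‖c‖⁻²` for `0 < ‖c‖ < min 1 (max ρ₀ 1)⁻¹` (when `0 ≤ R⋆ + 1`). [folklore] -/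
theorem le_radiusOf_of_norm_lt {Rstar : ℝ} (hRstar : 0 ≤ Rstar + 1) (ρ₀ : ℝ)
    {c : EuclideanSpace ℝ (Fin 1)} (hc : c ≠ 0) (h : ‖c‖ < min 1 (max ρ₀ 1)⁻¹) :
    ρ₀ ≤ radiusOf Rstar c := by
  have h1 : ‖c‖ < 1 := lt_of_lt_of_le h (min_le_left _ _)
  have h2 : ‖c‖ < (max ρ₀ 1)⁻¹ := lt_of_lt_of_le h (min_le_right _ _)
  have h3 := lt_inv_norm_sq hc (le_max_right ρ₀ 1) h1 h2
  have h4 : ρ₀ ≤ max ρ₀ 1 := le_max_left _ _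
  unfold radiusOf
  linarith

/-- **Smoothness at the junction for ONE section selector `σ` (`h` or `k`).** Let `S (R, t)` have
`σ`-sections jointly smooth on `{R⋆ < R}`, let the comparison family `E t` have `σ`-sections jointly
smooth with `σ (E 0) = σ d`, and suppose `σ (S (R, t)) x = σ (E t) x` for `x ∉ e.far R`, `R > R⋆`.
Then for every family `F` with `F 0 = d` and `F c = S (R⋆ + 1 + ‖c‖⁻², c₀)` for `c ≠ 0`, the
`σ`-section `(c, x) ↦ σ (F c) x` is jointly smooth: off `c = 0` by composition with the smooth
parameter map, at `(0, x)` because near it `F` has the sections of the smooth family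
`(c, x) ↦ σ (E c₀) x` (every point has a neighbourhood missing `e.far R` for all large `R`,
`AFEnd.exists_nhds_forall_not_mem_far`, and `R⋆ + 1 + ‖c‖⁻² → ∞`). [folklore] -/
theorem contMDiff_section_of_radiusCoord (d : InitialDataSet (𝓡 3) X) (e : AFEnd X) {Rstar : ℝ}
    (hRstar : 0 ≤ Rstar + 1)
    (S : ℝ × ℝ → InitialDataSet (𝓡 3) X) (E : ℝ → InitialDataSet (𝓡 3) X)
    (σ : InitialDataSet (𝓡 3) X → (x : X) → (TangentSpace (𝓡 3) x →L[ℝ] TangentSpace (𝓡 3) x →L[ℝ] ℝ))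
    (hS : ContMDiffOn ((𝓘(ℝ, ℝ).prod 𝓘(ℝ, ℝ)).prod (𝓡 3)) ((𝓡 3).prod 𝓘(ℝ, E3 →L[ℝ] E3 →L[ℝ] ℝ)) ∞
      (fun p : (ℝ × ℝ) × X ↦
        TotalSpace.mk' (F := E3 →L[ℝ] E3 →L[ℝ] ℝ)
          (E := fun x : X ↦ TangentSpace (𝓡 3) x →L[ℝ] TangentSpace (𝓡 3) x →L[ℝ] ℝ) p.2
          (σ (S p.1) p.2)) {p | Rstar < p.1.1})
    (hE : ContMDiff (𝓘(ℝ, ℝ).prod (𝓡 3)) ((𝓡 3).prod 𝓘(ℝ, E3 →L[ℝ] E3 →L[ℝ] ℝ)) ∞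
      (fun p : ℝ × X ↦
        TotalSpace.mk' (F := E3 →L[ℝ] E3 →L[ℝ] ℝ)
          (E := fun x : X ↦ TangentSpace (𝓡 3) x →L[ℝ] TangentSpace (𝓡 3) x →L[ℝ] ℝ) p.2
          (σ (E p.1) p.2)))
    (hE0 : ∀ x, σ (E 0) x = σ d x)
    (hSE : ∀ R t : ℝ, Rstar < R → ∀ x ∉ e.far R, σ (S (R, t)) x = σ (E t) x)
    (F : EuclideanSpace ℝ (Fin 1) → InitialDataSet (𝓡 3) X) (hF0 : F 0 = d)
    (hF : ∀ c ≠ 0, F c = S (radiusOf Rstar c, c 0)) :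
    ContMDiff (𝓘(ℝ, EuclideanSpace ℝ (Fin 1)).prod (𝓡 3)) ((𝓡 3).prod 𝓘(ℝ, E3 →L[ℝ] E3 →L[ℝ] ℝ)) ∞
      (fun q : EuclideanSpace ℝ (Fin 1) × X ↦
        TotalSpace.mk' (F := E3 →L[ℝ] E3 →L[ℝ] ℝ)
          (E := fun x : X ↦ TangentSpace (𝓡 3) x →L[ℝ] TangentSpace (𝓡 3) x →L[ℝ] ℝ) q.2
          (σ (F q.1) q.2)) := by
  rintro ⟨c, x⟩
  by_cases hc : c = 0
  · -- at the junction: agree with the comparison family near `(0, x)`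
    subst hc
    have hcomp := hE.comp contMDiff_coordMap
    apply (hcomp (0, x)).congr_of_eventuallyEq
    obtain ⟨V, hV, ρ₀, hVρ⟩ := AFEnd.exists_nhds_forall_not_mem_far e x
    have hε : 0 < min 1 (max ρ₀ 1)⁻¹ :=
      lt_min one_pos (inv_pos.2 (lt_of_lt_of_le one_pos (le_max_right _ _)))
    have hN : Metric.ball (0 : EuclideanSpace ℝ (Fin 1)) (min 1 (max ρ₀ 1)⁻¹) ×ˢ V ∈
        𝓝 ((0 : EuclideanSpace ℝ (Fin 1)), x) :=
      prod_mem_nhds (Metric.ball_mem_nhds _ hε) hV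
    filter_upwards [hN] with q ⟨hq1, hq2⟩
    rw [Metric.mem_ball, dist_zero_right] at hq1
    by_cases hq0 : q.1 = 0
    · simp only [Function.comp_apply, hq0, hF0, PiLp.zero_apply, hE0]
    · have hfar : q.2 ∉ e.far (radiusOf Rstar q.1) :=
        hVρ _ (le_radiusOf_of_norm_lt hRstar ρ₀ hq0 hq1) _ hq2
      simp only [Function.comp_apply, hF _ hq0, hSE _ _ (radiusOf_gt Rstar q.1) _ hfar]
  · -- off the junction: composition with the parameter map
    have hopen : IsOpen {q : EuclideanSpace ℝ (Fin 1) × X | q.1 ≠ 0} :=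
      isOpen_ne.preimage continuous_fst
    have hcomp := hS.comp (contMDiffOn_radiusCoordMap (X := X) Rstar)
      (fun q _ ↦ radiusOf_gt Rstar q.1)
    exact (hcomp.congr fun q hq ↦ by simp only [Function.comp_apply, hF _ hq]).contMDiffAt
      (hopen.mem_nhds hc)

/-! ## §3 Breathing a radius-indexed family below `R⋆` -/

section Breathe

variable [T2Space X] {e : AFEnd X} {z₀ : E3} {r Rstar : ℝ} (B : AFEnd.BreathingData e z₀ r)
  (hzr : ‖z₀‖ + r ≤ Rstar) {d : InitialDataSet (𝓡 3) X} {G : ℝ → InitialDataSet (𝓡 3) X}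
  (hGd : ∀ R : ℝ, Rstar < R → ∀ x ∉ e.far R, AgreeAt (G R) d x)

include hzr hGd in
/-- For a breathing ball below `R⋆` (`‖z₀‖ + r ≤ R⋆`) and `R > R⋆`: if `x ∉ e.far R` then `G R`
and `d` agree at the breathed point `breathe(σ t) x` (a point of the carrier is moved inside the
carrier, which lies below `R⋆`; any other point is fixed). [folklore] -/
theorem agreeAt_breathe_of_not_mem_far {R : ℝ} (hRR : Rstar < R) (t : ℝ) {x : X}
    (hx : x ∉ e.far R) : AgreeAt (G R) d (e.breathe z₀ r (AFEnd.squash B t) x) := by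
  refine hGd R hRR _ ?_
  by_cases hxc : x ∈ e.breatheCarrier z₀ r
  · exact not_mem_far_of_mem_carrier e hzr hRR.le
      ⟨(AFEnd.breathe_mem_and_coord B (AFEnd.abs_squash_lt_scale B t).2 hxc).1, by
        rw [(AFEnd.breathe_mem_and_coord B (AFEnd.abs_squash_lt_scale B t).2 hxc).2]
        exact AFEnd.phi_mem_ball_of_lt_invScale (AFEnd.abs_squash_lt_invScale B t) hxc.2⟩
  · rwa [e.breathe_of_not_mem hxc]

omit hzr hGd in
/-- Breathed data agree at `x` as soon as the data agree at the breathed point. [folklore] -/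
theorem agreeAt_breatheFamily {D D' : InitialDataSet (𝓡 3) X} (t : ℝ) {x : X}
    (hag : AgreeAt D D' (e.breathe z₀ r (AFEnd.squash B t) x)) :
    AgreeAt (AFEnd.breatheFamily B D t) (AFEnd.breatheFamily B D' t) x := by
  refine ⟨?_, ?_⟩
  · ext v w
    rw [AFEnd.breatheFamily_h_inner, AFEnd.breatheFamily_h_inner, hag.1]
  · ext v w
    rw [AFEnd.breatheFamily_k, AFEnd.breatheFamily_k, hag.2]

include hzr hGd in
/-- **The breathed radius family `S (R, t) := breathe(σ t)^* (G R)` has jointly smooth sections on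
`{R⋆ < R}`** when `G` has (the `key` step of the landed `stub_breathing` of the sibling crux
`SwallowTheDatum.ParametricKerrBurial`): on the carrier of the breathing ball `S (R, t)` has the
sections of the smooth breathing family `breathe(σ t)^* d` (there `G R = d` at the breathed point),
off the compact core it has the sections of `G R`. [folklore] -/
theorem smoothSectionsOn_breatheFamily_radius
    (hG : SmoothSectionsOn 𝓘(ℝ, ℝ) G {p : ℝ × X | Rstar < p.1}) :
    SmoothSectionsOn (𝓘(ℝ, ℝ).prod 𝓘(ℝ, ℝ))
      (fun q : ℝ × ℝ ↦ AFEnd.breatheFamily B (G q.1) q.2) {p : (ℝ × ℝ) × X | Rstar < p.1.1} := by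
  have hopen : IsOpen {p : (ℝ × ℝ) × X | Rstar < p.1.1} :=
    isOpen_lt continuous_const (continuous_fst.comp continuous_fst)
  have hproj₂ : ContMDiff ((𝓘(ℝ, ℝ).prod 𝓘(ℝ, ℝ)).prod (𝓡 3)) (𝓘(ℝ, ℝ).prod (𝓡 3)) ∞
      (fun q : (ℝ × ℝ) × X ↦ (q.1.2, q.2)) :=
    (contMDiff_snd.comp contMDiff_fst).prodMk contMDiff_snd
  have hproj₁ : ContMDiff ((𝓘(ℝ, ℝ).prod 𝓘(ℝ, ℝ)).prod (𝓡 3)) (𝓘(ℝ, ℝ).prod (𝓡 3)) ∞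
      (fun q : (ℝ × ℝ) × X ↦ (q.1.1, q.2)) :=
    (contMDiff_fst.comp contMDiff_fst).prodMk contMDiff_snd
  have hEh := AFEnd.contMDiff_breatheFamily_h B d
  have hEk := AFEnd.contMDiff_breatheFamily_k B d
  -- generic argument for a section `sec` (`h` or `k`)
  have key : ∀ (secS : Π q : (ℝ × ℝ) × X, TangentSpace (𝓡 3) q.2 →L[ℝ] TangentSpace (𝓡 3) q.2 →L[ℝ] ℝ)
      (secE : Π q : ℝ × X, TangentSpace (𝓡 3) q.2 →L[ℝ] TangentSpace (𝓡 3) q.2 →L[ℝ] ℝ)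
      (secP : Π q : ℝ × X, TangentSpace (𝓡 3) q.2 →L[ℝ] TangentSpace (𝓡 3) q.2 →L[ℝ] ℝ),
      ContMDiff (𝓘(ℝ, ℝ).prod (𝓡 3)) ((𝓡 3).prod 𝓘(ℝ, E3 →L[ℝ] E3 →L[ℝ] ℝ)) ∞
        (fun q : ℝ × X ↦ TotalSpace.mk' (E3 →L[ℝ] E3 →L[ℝ] ℝ)
          (E := fun x : X ↦ TangentSpace (𝓡 3) x →L[ℝ] TangentSpace (𝓡 3) x →L[ℝ] ℝ) q.2 (secE q)) →
      ContMDiffOn (𝓘(ℝ, ℝ).prod (𝓡 3)) ((𝓡 3).prod 𝓘(ℝ, E3 →L[ℝ] E3 →L[ℝ] ℝ)) ∞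
        (fun q : ℝ × X ↦ TotalSpace.mk' (E3 →L[ℝ] E3 →L[ℝ] ℝ)
          (E := fun x : X ↦ TangentSpace (𝓡 3) x →L[ℝ] TangentSpace (𝓡 3) x →L[ℝ] ℝ) q.2 (secP q))
        {p : ℝ × X | Rstar < p.1} →
      (∀ q : (ℝ × ℝ) × X, Rstar < q.1.1 → q.2 ∈ e.breatheCarrier z₀ r → secS q = secE (q.1.2, q.2)) →
      (∀ q : (ℝ × ℝ) × X, q.2 ∉ AFEnd.breatheCore e z₀ r → secS q = secP (q.1.1, q.2)) →
      ContMDiffOn ((𝓘(ℝ, ℝ).prod 𝓘(ℝ, ℝ)).prod (𝓡 3)) ((𝓡 3).prod 𝓘(ℝ, E3 →L[ℝ] E3 →L[ℝ] ℝ)) ∞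
        (fun q : (ℝ × ℝ) × X ↦ TotalSpace.mk' (E3 →L[ℝ] E3 →L[ℝ] ℝ)
          (E := fun x : X ↦ TangentSpace (𝓡 3) x →L[ℝ] TangentSpace (𝓡 3) x →L[ℝ] ℝ) q.2 (secS q))
        {p : (ℝ × ℝ) × X | Rstar < p.1.1} := by
    intro secS secE secP hE hP hcar hcore q hq
    have hq' : Rstar < q.1.1 := hq
    apply ContMDiffAt.contMDiffWithinAt
    by_cases hx : q.2 ∈ e.breatheCarrier z₀ r
    · -- on the carrier `S = E`
      have hsm : ContMDiffAt ((𝓘(ℝ, ℝ).prod 𝓘(ℝ, ℝ)).prod (𝓡 3)) ((𝓡 3).prod 𝓘(ℝ, E3 →L[ℝ] E3 →L[ℝ] ℝ)) ∞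
          (fun q : (ℝ × ℝ) × X ↦ TotalSpace.mk' (E3 →L[ℝ] E3 →L[ℝ] ℝ)
            (E := fun x : X ↦ TangentSpace (𝓡 3) x →L[ℝ] TangentSpace (𝓡 3) x →L[ℝ] ℝ) q.2
              (secE (q.1.2, q.2))) q :=
        (hE (q.1.2, q.2)).comp q (hproj₂ q)
      refine hsm.congr_of_eventuallyEq ?_
      have hev₁ : ∀ᶠ p : (ℝ × ℝ) × X in 𝓝 q, Rstar < p.1.1 := hopen.mem_nhds hq'
      have hev₂ : ∀ᶠ p : (ℝ × ℝ) × X in 𝓝 q, p.2 ∈ e.breatheCarrier z₀ r :=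
        (continuousAt_snd (p := q)).preimage_mem_nhds ((e.isOpen_breatheCarrier z₀ r).mem_nhds hx)
      have hev := hev₁.and hev₂
      filter_upwards [hev] with p hp
      rw [hcar p hp.1 hp.2]
    · -- off the carrier, hence off the moved set: `S = G`
      have hK : q.2 ∉ AFEnd.breatheCore e z₀ r := fun h ↦ hx (AFEnd.breatheCore_subset_carrier B h)
      have hmem : (q.1.1, q.2) ∈ {p : ℝ × X | Rstar < p.1} := hq'
      have hPat : ContMDiffAt (𝓘(ℝ, ℝ).prod (𝓡 3)) ((𝓡 3).prod 𝓘(ℝ, E3 →L[ℝ] E3 →L[ℝ] ℝ)) ∞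
          (fun q : ℝ × X ↦ TotalSpace.mk' (E3 →L[ℝ] E3 →L[ℝ] ℝ)
            (E := fun x : X ↦ TangentSpace (𝓡 3) x →L[ℝ] TangentSpace (𝓡 3) x →L[ℝ] ℝ) q.2 (secP q))
          (q.1.1, q.2) :=
        (hP _ hmem).contMDiffAt ((isOpen_lt continuous_const continuous_fst).mem_nhds hmem)
      have hsm : ContMDiffAt ((𝓘(ℝ, ℝ).prod 𝓘(ℝ, ℝ)).prod (𝓡 3)) ((𝓡 3).prod 𝓘(ℝ, E3 →L[ℝ] E3 →L[ℝ] ℝ)) ∞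
          (fun q : (ℝ × ℝ) × X ↦ TotalSpace.mk' (E3 →L[ℝ] E3 →L[ℝ] ℝ)
            (E := fun x : X ↦ TangentSpace (𝓡 3) x →L[ℝ] TangentSpace (𝓡 3) x →L[ℝ] ℝ) q.2
              (secP (q.1.1, q.2))) q :=
        hPat.comp q (hproj₁ q)
      refine hsm.congr_of_eventuallyEq ?_
      have hev : ∀ᶠ p : (ℝ × ℝ) × X in 𝓝 q, p.2 ∉ AFEnd.breatheCore e z₀ r :=
        (continuousAt_snd (p := q)).preimage_mem_nhds
          ((AFEnd.isCompact_breatheCore B).isClosed.isOpen_compl.mem_nhds hK)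
      filter_upwards [hev] with p hp
      rw [hcore p hp]
  refine ⟨key (fun q ↦ (AFEnd.breatheFamily B (G q.1.1) q.1.2).h.inner q.2)
      (fun q ↦ (AFEnd.breatheFamily B d q.1).h.inner q.2) (fun q ↦ (G q.1).h.inner q.2)
      hEh hG.1 (fun q hq hx ↦ ?_) (fun q hx ↦ ?_),
    key (fun q ↦ (AFEnd.breatheFamily B (G q.1.1) q.1.2).k q.2)
      (fun q ↦ (AFEnd.breatheFamily B d q.1).k q.2) (fun q ↦ (G q.1).k q.2)
      hEk hG.2 (fun q hq hx ↦ ?_) (fun q hx ↦ ?_)⟩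
  · exact (agreeAt_breatheFamily B q.1.2 (agreeAt_breathe_of_not_mem_far B hzr hGd hq q.1.2
      (not_mem_far_of_mem_carrier e hzr hq.le hx))).1
  · exact (AFEnd.breatheFamily_eq_of_not_mem_core B (G q.1.1) q.1.2 hx).1
  · exact (agreeAt_breatheFamily B q.1.2 (agreeAt_breathe_of_not_mem_far B hzr hGd hq q.1.2
      (not_mem_far_of_mem_carrier e hzr hq.le hx))).2
  · exact (AFEnd.breatheFamily_eq_of_not_mem_core B (G q.1.1) q.1.2 hx).2

end Breathe

/-- **Registered form of §3** (stub `breatheFamilyRadius_smoothSections` of crux `TameEscapeToKerrEnds`,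
stmt-FinalStateConjecture-18522: the smoothness sub-goal of the tame junction S3b): breathing a
radius-indexed family agreeing with `d` off `e.far R` in a ball below `R⋆` yields jointly smooth
sections on `{R⋆ < R}`. [folklore] -/
theorem breatheFamilyRadius_smoothSections :
    ∀ (X : Type) [TopologicalSpace X] [ChartedSpace E3 X] [IsManifold (𝓡 3) ∞ X] [T2Space X]
      (e : AFEnd X) (z₀ : E3) (r Rstar : ℝ) (B : AFEnd.BreathingData e z₀ r)
      (d : InitialDataSet (𝓡 3) X) (G : ℝ → InitialDataSet (𝓡 3) X),
      ‖z₀‖ + r ≤ Rstar → (∀ R : ℝ, Rstar < R → ∀ x ∉ e.far R, AgreeAt (G R) d x) →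
      SmoothSectionsOn 𝓘(ℝ, ℝ) G {p : ℝ × X | Rstar < p.1} →
      SmoothSectionsOn (𝓘(ℝ, ℝ).prod 𝓘(ℝ, ℝ))
        (fun q : ℝ × ℝ ↦ AFEnd.breatheFamily B (G q.1) q.2) {p : (ℝ × ℝ) × X | Rstar < p.1.1} :=
  fun _ _ _ _ _ _ _ _ _ B _ _ hzr hGd hG ↦ smoothSectionsOn_breatheFamily_radius B hzr hGd hG

end Summit.FinalStateConjecture.FinalStateConjecture.Theorems.ExactKerrEnds

end
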